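import Summits.AtomisticToContinuum.BoseEinsteinCondensation.Theses.BECSwapNoCatastrophe

/-!
# AtomisticToContinuum / BoseEinsteinCondensation — route `BECSwapNoCatastrophe`, assembly

Settles the assembly item `stmt-AtomisticToContinuum-14398` of route
`route-AtomisticToContinuum-BECSwapNoCatastrophe`: the implication
`TorusHalfSwapOverlap → MidpointLemma → TorusPhaseRigidity → SwapToZeroMode →
BoundaryTransferWeak → BoseEinsteinCondensation`.

The hypotheses of `Assembly` are, verbatim and in the same order, those of the route's deciding
theorem `closes`, so the assembly is that theorem curried; the composition is spelled out again
below for the record: fix `v`, `hv : IsRepulsiveFiniteRange v`; `MidpointLemma` turns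
`TorusHalfSwapOverlap` into the target `TorusSwapBound`; `SwapToZeroMode`, fed `TorusPhaseRigidity`
and `TorusSwapBound`, yields the periodic-BEC body (constant-mode occupation `≥ cN` for periodic
near-minimisers), which at `v` is exactly the hypothesis of `BoundaryTransferWeak v hv`, whose
conclusion is the conjunct's body at `v`. Pure logic; no analytic content lives here.
-/

namespace Summit.AtomisticToContinuum.BoseEinsteinCondensation.Theorems

/-- Settles `stmt-AtomisticToContinuum-14398` (exact signature): the assembly of route
`BECSwapNoCatastrophe`, i.e. its five deciding items imply the sub-problem statement
`BoseEinsteinCondensation`. Proof: for each repulsive finite-range `v`, `BoundaryTransferWeak`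
applied to the periodic BEC delivered by `SwapToZeroMode` from `TorusPhaseRigidity` and the swap
bound `MidpointLemma TorusHalfSwapOverlap` (the route's `closes`, curried). [folklore] -/
theorem becSwapNoCatastrophe_assembly_proof :
    Summit.AtomisticToContinuum.BoseEinsteinCondensation.Theses.BECSwapNoCatastrophe.Assembly := by
  unfold Theses.BECSwapNoCatastrophe.Assembly
  intro h2 hM h6 hZ h5
  exact fun v hv => h5 v hv ((hZ h6 (hM h2)) v hv)

end Summit.AtomisticToContinuum.BoseEinsteinCondensation.Theorems
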